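import Summits.QuantumFields.YangMills.Theorems.PoincareLipschitzAxialShear
import Literature.Analysis.FunctionSpaces.SobolevDomain
import Mathlib.Analysis.Calculus.FDeriv.Symmetric
import HarnessLib

/-!
# Crux `BlockLipschitzL` (stmt-QuantumFields-23533) ∕ `HistoryTailL` (stmt-QuantumFields-19936), LINE 25 «CompactnessTransfer»,
# stub S1″ row (M) «MONOTONICITY» — FILE β «THE WEAK CHAIN RULE UNDER AN AXIAL SHEAR»

Cell `ym3-torus` (YM ladder rung R3 = continuum SU(2) Yang–Mills on T³ — a RUNG, NOT the Clay problem: not d = 4, not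
infinite volume, not a mass gap); WIDTH helper seat `ym-ust-19936-w2` g13.  Helper `--supports stmt-QuantumFields-19936`;
THEOREMS ONLY (0 `def`, 0 `sorry`, default heartbeats); imports: FILE α ✓`PoincareLipschitzAxialShear` (shear bijection,
Sherman–Morrison, Jacobian, change of variables on invariant sets), lit ✓`SobolevDomain` (`IsTestFunctionOn`, `HasWeakFDerivOn`),
Mathlib (`FDeriv.Symmetric`).

WHAT THIS FILE DOES.  For the axial shear `Ψ_h z := z − h z • e` of FILE α (`h ∈ C^∞` compactly supported inside the open
set `Ω`, `‖Dh‖ ≤ L < 1`, `‖e‖ ≤ 1`) with inverse `Φ`, and a weakly differentiable `U` on `Ω` with weak gradient `G`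
(lit `HasWeakFDerivOn Ω μ U G`), the competitor `W := U ∘ Φ` is weakly differentiable on `Ω` with the EXPLICIT weak
gradient `GW x := G(Φ x) ∘ A(Φ x)`, `A z := (DΨ_z)⁻¹ = id + (1 − Dh_z e)⁻¹ • Dh_z ⊗ e` (★★★ `hasWeakFDerivOn_comp_inverse`).
Proof = test side only, no approximation: substitute `x = Ψ z` (FILE α), put `ψ := φ ∘ Ψ`, and use the ONE pointwise
identity `(1 − ∂_e h)·∂_vψ + ∂_vh·∂_eψ = ∂_v[(1 − ∂_e h)ψ] + ∂_e[∂_vh·ψ]` (★ `jacobian_mul_fderiv_comp_shear`) — the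
Piola term is `∂_e∂_vh − ∂_v∂_eh = 0` (symmetry of second derivatives); then integrate by parts against the two test
functions `(1 − ∂_e h)ψ` and `∂_vh·ψ`.  Also: `W = U` off `tsupport h` and `W` takes the values of `U|_Ω` on `Ω`.

HONEST SCOPE.  Sobolev calculus; nothing of (M), (C), (R), S1″, S2♭″, `hHalvingBand`, K1, `MeanDeviationL`, `BlockLipschitzL`,
`HistoryTailL` is proved here.  YM₃ on T³ is rung R3, not Clay; YM gap NOT proved; no summit statement is proved here.

References: L. C. Evans, Partial Differential Equations, 2nd ed. (2010) [Evans2010] (§5.2.1 weak derivatives);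
W. P. Ziemer, Weakly Differentiable Functions (1989) [Ziemer1989] (Thm 2.2.2: Sobolev functions under bi-Lipschitz
changes of variables); L. Simon, Theorems on Regularity and Singularity of Energy Minimizing Maps (1996) [Simon1996] (§2.2).
-/

set_option autoImplicit false

noncomputable section

open MeasureTheory Set Function Filter Topology Metric TopologicalSpace
open scoped ContDiff

namespace Summit.QuantumFields.YangMills.Theorems.PoincareLipschitzWeakChainRuleShear

open Literature.Analysis.FunctionSpaces (IsTestFunctionOn HasWeakFDerivOn)
open Summit.QuantumFields.YangMills.Theorems.PoincareLipschitzAxialShear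

variable {E : Type*} [NormedAddCommGroup E] [NormedSpace ℝ E]
variable {h : E → ℝ} {e : E} {L : ℝ}

/-! ## §1 Smoothness letters for the shear data -/

/-- **The shear is smooth.** [folklore] -/
theorem contDiff_shear (hh : ContDiff ℝ ∞ h) : ContDiff ℝ ∞ (fun z : E => z - h z • e) :=
  contDiff_id.sub (hh.smul contDiff_const)

/-- **Directional derivatives of a smooth function are smooth.** [folklore] -/
theorem contDiff_fderiv_apply (hh : ContDiff ℝ ∞ h) (v : E) : ContDiff ℝ ∞ (fun z : E => fderiv ℝ h z v) :=
  (contDiff_infty_iff_fderiv.mp hh).2.clm_apply contDiff_const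

/-- **The Jacobian `1 − Dh_z e` is smooth.** [folklore] -/
theorem contDiff_jacobian (hh : ContDiff ℝ ∞ h) : ContDiff ℝ ∞ (fun z : E => 1 - fderiv ℝ h z e) :=
  contDiff_const.sub (contDiff_fderiv_apply hh e)

/-- **Second directional derivatives**: `∂_w (∂_v h) = D²h(w)(v)`. [folklore] -/
theorem fderiv_fderiv_apply (hh : ContDiff ℝ ∞ h) (z v w : E) :
    fderiv ℝ (fun y => fderiv ℝ h y v) z w = fderiv ℝ (fderiv ℝ h) z w v := by
  have hd : DifferentiableAt ℝ (fderiv ℝ h) z :=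
    ((contDiff_infty_iff_fderiv.mp hh).2.differentiable (by simp)) z
  rw [fderiv_clm_apply hd (differentiableAt_const v)]
  simp

/-- **Symmetry of second derivatives** for the smooth `h`. [folklore] -/
theorem fderiv_fderiv_symm (hh : ContDiff ℝ ∞ h) (z v w : E) :
    fderiv ℝ (fderiv ℝ h) z v w = fderiv ℝ (fderiv ℝ h) z w v :=
  (hh.contDiffAt.isSymmSndFDerivAt (n := ∞)
    (by rw [minSmoothness_of_isRCLikeNormedField]; exact WithTop.coe_le_coe.2 le_top)) v w

/-! ## §2 Test functions: pull-back by the shear and smooth multipliers -/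

/-- **A smooth multiple of a test function is a test function.** [cite: Evans2010, §5.2.1] -/
theorem isTestFunctionOn_mul_left {Ω : Opens E} {ψ c : E → ℝ} (hψ : IsTestFunctionOn Ω ψ) (hc : ContDiff ℝ ∞ c) :
    IsTestFunctionOn Ω (fun z => c z * ψ z) where
  contDiff := hc.mul hψ.contDiff
  hasCompactSupport := by
    have : HasCompactSupport (c * ψ) := hψ.hasCompactSupport.mul_left
    exact this
  tsupport_subset := by
    have : tsupport (c * ψ) ⊆ tsupport ψ := tsupport_mul_subset_right
    exact this.trans hψ.tsupport_subset

/-- **The support of a pull-back by the shear** lies in the preimage of the support. [folklore] -/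
theorem tsupport_comp_shear_subset (hc : Continuous h) (φ : E → ℝ) :
    tsupport (fun z => φ (z - h z • e)) ⊆ (fun z : E => z - h z • e) ⁻¹' (tsupport φ) := by
  refine closure_minimal ?_ ((isClosed_tsupport φ).preimage (continuous_shear hc))
  intro z hz
  exact subset_closure hz

/-- **The pull-back of a test function on `Ω` by the shear is a test function on `Ω`** (`tsupport h ⊆ Ω`, `E` proper).
[cite: Evans2010, §5.2.1] -/
theorem isTestFunctionOn_comp_shear [ProperSpace E] {Ω : Opens E} (hh : ContDiff ℝ ∞ h) (hsupp : HasCompactSupport h)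
    (hΩ : tsupport h ⊆ (Ω : Set E)) (hinj : Injective (fun z : E => z - h z • e)) {φ : E → ℝ}
    (hφ : IsTestFunctionOn Ω φ) : IsTestFunctionOn Ω (fun z => φ (z - h z • e)) := by
  have hpre := tsupport_comp_shear_subset (e := e) hh.continuous φ
  refine ⟨hφ.contDiff.comp (contDiff_shear hh), ?_, ?_⟩
  · exact IsCompact.of_isClosed_subset (isCompact_preimage_shear hh.continuous hsupp hφ.hasCompactSupport)
      (isClosed_tsupport _) hpre
  · refine hpre.trans ((preimage_mono hφ.tsupport_subset).trans ?_)
    rw [preimage_eq_of_tsupport_subset hinj hΩ]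

/-! ## §3 The pointwise Piola identity -/

/-- ★ **THE POINTWISE IDENTITY BEHIND THE WEAK CHAIN RULE.**  With `ψ := φ ∘ Ψ_h`, `J := 1 − ∂_e h`:
`J(z)·(∂_vφ)(Ψ_h z) = ∂_v[J·ψ](z) + ∂_e[∂_vh·ψ](z)` — the chain rule `dφ_{Ψz} = dψ_z ∘ (DΨ_z)⁻¹` (Sherman–Morrison,
FILE α) plus the product rule; the second-order terms `ψ·(∂_e∂_vh − ∂_v∂_eh)` cancel by the symmetry of `D²h`
(the Piola identity for the shear). [cite: Ziemer1989, Thm 2.2.2] -/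
theorem jacobian_mul_fderiv_comp_shear (hh : ContDiff ℝ ∞ h) {φ : E → ℝ} (hφ : ContDiff ℝ ∞ φ) (z v : E)
    (hne : fderiv ℝ h z e ≠ 1) :
    (1 - fderiv ℝ h z e) * fderiv ℝ φ (z - h z • e) v =
      fderiv ℝ (fun y => (1 - fderiv ℝ h y e) * φ (y - h y • e)) z v +
        fderiv ℝ (fun y => fderiv ℝ h y v * φ (y - h y • e)) z e := by
  have hJ : (1 - fderiv ℝ h z e) ≠ 0 := sub_ne_zero.mpr (Ne.symm hne)
  have hhd : Differentiable ℝ h := hh.differentiable (by simp)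
  have hφd : Differentiable ℝ φ := hφ.differentiable (by simp)
  -- the chain rule for `ψ := φ ∘ Ψ`
  have hψ : HasFDerivAt (fun y => φ (y - h y • e))
      ((fderiv ℝ φ (z - h z • e)).comp (ContinuousLinearMap.id ℝ E - (fderiv ℝ h z).smulRight e)) z :=
    (hφd _).hasFDerivAt.comp z (hasFDerivAt_shear (hhd z))
  have hψd : DifferentiableAt ℝ (fun y => φ (y - h y • e)) z := hψ.differentiableAt
  have hJd : DifferentiableAt ℝ (fun y => 1 - fderiv ℝ h y e) z :=
    ((contDiff_jacobian hh).differentiable (by simp)) z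
  have hvd : DifferentiableAt ℝ (fun y => fderiv ℝ h y v) z :=
    ((contDiff_fderiv_apply hh v).differentiable (by simp)) z
  -- `dφ_{Ψ z} v` through `(DΨ_z)⁻¹`
  have hinv := congrArg (fun T : E →L[ℝ] E => fderiv ℝ φ (z - h z • e) (T v))
    (id_sub_smulRight_comp_inv (fderiv ℝ h z) e hne)
  simp only [ContinuousLinearMap.comp_apply, ContinuousLinearMap.id_apply] at hinv
  -- hinv : fderiv φ (Ψ z) ((id - c⊗e) (A v)) = fderiv φ (Ψ z) v
  have eq_lhs : (1 - fderiv ℝ h z e) * fderiv ℝ φ (z - h z • e) v =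
      (1 - fderiv ℝ h z e) * fderiv ℝ (fun y => φ (y - h y • e)) z v +
        fderiv ℝ h z v * fderiv ℝ (fun y => φ (y - h y • e)) z e := by
    rw [hψ.fderiv, ← hinv, inv_apply]
    simp only [ContinuousLinearMap.comp_apply, map_add, map_smul, smul_eq_mul]
    field_simp
  have eq_P : fderiv ℝ (fun y => (1 - fderiv ℝ h y e) * φ (y - h y • e)) z v =
      (1 - fderiv ℝ h z e) * fderiv ℝ (fun y => φ (y - h y • e)) z v -
        φ (z - h z • e) * fderiv ℝ (fderiv ℝ h) z v e := by
    rw [fderiv_fun_mul hJd hψd]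
    simp only [add_apply, FunLike.coe_smul, Pi.smul_apply, smul_eq_mul]
    rw [fderiv_const_sub, neg_apply, fderiv_fderiv_apply hh]
    ring
  have eq_R : fderiv ℝ (fun y => fderiv ℝ h y v * φ (y - h y • e)) z e =
      fderiv ℝ h z v * fderiv ℝ (fun y => φ (y - h y • e)) z e +
        φ (z - h z • e) * fderiv ℝ (fderiv ℝ h) z e v := by
    rw [fderiv_fun_mul hvd hψd]
    simp only [add_apply, FunLike.coe_smul, Pi.smul_apply, smul_eq_mul]
    rw [fderiv_fderiv_apply hh]
  rw [eq_lhs, eq_P, eq_R, fderiv_fderiv_symm hh z v e]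
  ring

/-! ## §4 Integrability letters -/

omit [NormedSpace ℝ E] in
/-- **A continuous, compactly supported multiplier times a locally integrable function is integrable on `Ω`.**
[cite: Evans2010, §5.2.1] -/
theorem integrableOn_smul_of_locallyIntegrableOn [MeasurableSpace E] [OpensMeasurableSpace E] {μ : Measure E}
    {F : Type*} [NormedAddCommGroup F] [NormedSpace ℝ F] {Ω : Opens E} {f : E → F}
    (hf : LocallyIntegrableOn f (Ω : Set E) μ) {c : E → ℝ} (hc : Continuous c) (hcs : HasCompactSupport c)
    (hcΩ : tsupport c ⊆ (Ω : Set E)) : IntegrableOn (fun x => c x • f x) (Ω : Set E) μ := by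
  have hK : IntegrableOn (fun x => c x • f x) (tsupport c) μ :=
    (hf.integrableOn_compact_subset hcΩ hcs).continuousOn_smul hc.continuousOn hcs
  refine hK.of_forall_sdiff_eq_zero Ω.isOpen.measurableSet fun x hx => ?_
  rw [image_eq_zero_of_notMem_tsupport hx.2, zero_smul]

/-- **The Jacobian-weighted inverse is a smooth operator field**: `(1 − Dh_z e) • A_z = (1 − Dh_z e) • id + Dh_z ⊗ e`,
and `z ↦ Dh_z ⊗ e = D(h • e)_z` is continuous. [folklore] -/
theorem continuous_jacobian_smul_inv (hh : ContDiff ℝ ∞ h) :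
    Continuous (fun z : E => (1 - fderiv ℝ h z e) • ContinuousLinearMap.id ℝ E + (fderiv ℝ h z).smulRight e) := by
  have h1 : ContDiff ℝ ∞ (fun y : E => h y • e) := hh.smul contDiff_const
  have h2 : Continuous (fderiv ℝ (fun y : E => h y • e)) := h1.continuous_fderiv (by simp)
  have h3 : (fun z : E => (fderiv ℝ h z).smulRight e) = fderiv ℝ (fun y : E => h y • e) := by
    funext z
    rw [fderiv_smul_const ((hh.differentiable (by simp)) z)]
  have h4 : Continuous (fun z : E => (fderiv ℝ h z).smulRight e) := by rw [h3]; exact h2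
  exact ((contDiff_jacobian hh).continuous.smul continuous_const).add h4

/-- **Algebra**: `J • A = J • id + Dh ⊗ e` when `J = 1 − Dh_z e ≠ 0`. [folklore] -/
theorem jacobian_smul_inv_eq {z : E} (hne : fderiv ℝ h z e ≠ 1) :
    (1 - fderiv ℝ h z e) • (ContinuousLinearMap.id ℝ E + (1 - fderiv ℝ h z e)⁻¹ • (fderiv ℝ h z).smulRight e) =
      (1 - fderiv ℝ h z e) • ContinuousLinearMap.id ℝ E + (fderiv ℝ h z).smulRight e := by
  have hJ : (1 - fderiv ℝ h z e) ≠ 0 := sub_ne_zero.mpr (Ne.symm hne)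
  rw [smul_add, smul_smul, mul_inv_cancel₀ hJ, one_smul]

/-! ## §5 The weak chain rule -/

variable [MeasurableSpace E] [BorelSpace E] [FiniteDimensional ℝ E] {μ : Measure E} [μ.IsAddHaarMeasure]
variable {F : Type*} [NormedAddCommGroup F] [NormedSpace ℝ F]

/-- ★★★ **THE WEAK CHAIN RULE UNDER AN AXIAL SHEAR.**  Let `h ∈ C^∞(E)` have compact support inside the open set
`Ω`, `‖Dh‖ ≤ L < 1`, `‖e‖ ≤ 1`, let `Φ` be the inverse of the shear `Ψ_h z := z − h z • e` (FILE α `exists_inverse`), and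
let `U` be weakly differentiable on `Ω` with weak gradient `G`.  Then `W := U ∘ Φ` is weakly differentiable on `Ω` with
weak gradient `GW x := G(Φ x) ∘ A(Φ x)`, `A z := id + (1 − Dh_z e)⁻¹ • Dh_z ⊗ e = (DΨ_z)⁻¹`.
Proof: local integrability of `W` and `GW` by the change of variables of FILE α on the invariant compact sets
`K ∪ tsupport h`; the integration-by-parts identity by substituting `x = Ψ z`, the pointwise identity
`jacobian_mul_fderiv_comp_shear`, and `U`'s identity against the test functions `(1 − ∂_e h)·(φ ∘ Ψ)` and `∂_vh·(φ ∘ Ψ)`.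
[cite: Ziemer1989, Thm 2.2.2; Evans2010, §5.2.1] -/
theorem hasWeakFDerivOn_comp_inverse {Ω : Opens E} (hh : ContDiff ℝ ∞ h) (hsupp : HasCompactSupport h)
    (hΩ : tsupport h ⊆ (Ω : Set E)) (hL : ∀ z, ‖fderiv ℝ h z‖ ≤ L) (he : ‖e‖ ≤ 1) (hL1 : L < 1)
    {Φ : E → E} (hΦl : LeftInverse Φ (fun z : E => z - h z • e))
    (hΦr : RightInverse Φ (fun z : E => z - h z • e))
    {U : E → F} {G : E → E →L[ℝ] F} (hU : HasWeakFDerivOn Ω μ U G) :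
    HasWeakFDerivOn Ω μ (fun x => U (Φ x))
      (fun x => (G (Φ x)).comp
        (ContinuousLinearMap.id ℝ E + (1 - fderiv ℝ h (Φ x) e)⁻¹ • (fderiv ℝ h (Φ x)).smulRight e)) := by
  have hhd : Differentiable ℝ h := hh.differentiable (by simp)
  have hinj : Injective (fun z : E => z - h z • e) := shear_injective hhd hL he hL1
  have hne : ∀ z : E, fderiv ℝ h z e ≠ 1 := fun z => fderiv_apply_ne_one (hL z) he hL1
  have hΩlc : IsLocallyClosed (Ω : Set E) := Ω.isOpen.isLocallyClosed
  -- compact invariant envelopes of compact subsets of `Ω`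
  have henv : ∀ K : Set E, K ⊆ (Ω : Set E) → IsCompact K →
      IsCompact (K ∪ tsupport h) ∧ K ∪ tsupport h ⊆ (Ω : Set E) ∧ tsupport h ⊆ K ∪ tsupport h :=
    fun K hK hKc => ⟨hKc.union hsupp, union_subset hK hΩ, subset_union_right⟩
  refine ⟨?_, ?_, fun φ v hφ => ?_⟩
  · -- local integrability of `W`
    rw [locallyIntegrableOn_iff hΩlc]
    intro K hK hKc
    obtain ⟨hK'c, hK'Ω, hK's⟩ := henv K hK hKc
    have hUK' : IntegrableOn U (K ∪ tsupport h) μ := hU.locallyIntegrableOn.integrableOn_compact_subset hK'Ω hK'c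
    have h1 : IntegrableOn (fun z => (1 - fderiv ℝ h z e) • U z) (K ∪ tsupport h) μ :=
      hUK'.continuousOn_smul (contDiff_jacobian hh).continuous.continuousOn hK'c
    exact ((integrableOn_comp_inverse_iff μ hhd hL he hL1 hΦl hK'c.measurableSet hK's U).mpr h1).mono_set
      subset_union_left
  · -- local integrability of `GW`
    rw [locallyIntegrableOn_iff hΩlc]
    intro K hK hKc
    obtain ⟨hK'c, hK'Ω, hK's⟩ := henv K hK hKc
    have hGK' : IntegrableOn G (K ∪ tsupport h) μ :=
      hU.locallyIntegrableOn_deriv.integrableOn_compact_subset hK'Ω hK'c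
    -- the field `B z := (1 - Dh_z e) • A z` is continuous, hence bounded on the compact envelope
    have hBc := continuous_jacobian_smul_inv (e := e) hh
    obtain ⟨M, hM⟩ := hK'c.exists_bound_of_continuousOn hBc.continuousOn
    have hmeas : AEStronglyMeasurable
        (fun z => (G z).comp ((1 - fderiv ℝ h z e) • ContinuousLinearMap.id ℝ E + (fderiv ℝ h z).smulRight e))
        (μ.restrict (K ∪ tsupport h)) := by
      have := (ContinuousLinearMap.compL ℝ E E F).aestronglyMeasurable_comp₂ hGK'.aestronglyMeasurable
        (hBc.continuousOn.aestronglyMeasurable hK'c.measurableSet)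
      simpa only [ContinuousLinearMap.compL_apply] using this
    have h1 : IntegrableOn
        (fun z => (G z).comp ((1 - fderiv ℝ h z e) • ContinuousLinearMap.id ℝ E + (fderiv ℝ h z).smulRight e))
        (K ∪ tsupport h) μ := by
      refine Integrable.mono' (hGK'.norm.mul_const M) hmeas ?_
      filter_upwards [ae_restrict_mem hK'c.measurableSet] with z hz
      exact (ContinuousLinearMap.opNorm_comp_le _ _).trans (mul_le_mul_of_nonneg_left (hM z hz) (norm_nonneg _))
    have h2 : IntegrableOn (fun z => (1 - fderiv ℝ h z e) •
        ((G z).comp (ContinuousLinearMap.id ℝ E + (1 - fderiv ℝ h z e)⁻¹ • (fderiv ℝ h z).smulRight e)))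
        (K ∪ tsupport h) μ := by
      refine h1.congr_fun (fun z _ => ?_) hK'c.measurableSet
      rw [← ContinuousLinearMap.comp_smul, jacobian_smul_inv_eq (hne z)]
    exact ((integrableOn_comp_inverse_iff μ hhd hL he hL1 hΦl hK'c.measurableSet hK's
      (fun z => (G z).comp (ContinuousLinearMap.id ℝ E + (1 - fderiv ℝ h z e)⁻¹ • (fderiv ℝ h z).smulRight e))).mpr
      h2).mono_set subset_union_left
  · -- the integration-by-parts identity
    have hΩm : MeasurableSet (Ω : Set E) := Ω.isOpen.measurableSet
    -- the pulled-back test function and its two smooth multiples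
    have hψ : IsTestFunctionOn Ω (fun z => φ (z - h z • e)) := isTestFunctionOn_comp_shear hh hsupp hΩ hinj hφ
    have hP : IsTestFunctionOn Ω (fun z => (1 - fderiv ℝ h z e) * φ (z - h z • e)) :=
      isTestFunctionOn_mul_left hψ (contDiff_jacobian hh)
    have hR : IsTestFunctionOn Ω (fun z => fderiv ℝ h z v * φ (z - h z • e)) :=
      isTestFunctionOn_mul_left hψ (contDiff_fderiv_apply hh v)
    have IP := hU.integral_fderiv_smul_eq _ v hP
    have IR := hU.integral_fderiv_smul_eq _ e hR
    -- Step 1: substitute `x = Ψ z` on the left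
    have S1 : ∫ x in (Ω : Set E), (fderiv ℝ φ x v) • U (Φ x) ∂μ =
        ∫ z in (Ω : Set E), (1 - fderiv ℝ h z e) • ((fderiv ℝ φ (z - h z • e) v) • U z) ∂μ := by
      have := setIntegral_comp_inverse_eq μ hhd hL he hL1 hΦl hΩm hΩ
        (fun y => (fderiv ℝ φ (y - h y • e) v) • U y)
      refine Eq.trans (setIntegral_congr_fun hΩm fun x _ => ?_) this
      have hx : Φ x - h (Φ x) • e = x := hΦr x
      simp only [hx]
    -- Step 2: the pointwise identity
    have S2 : ∫ z in (Ω : Set E), (1 - fderiv ℝ h z e) • ((fderiv ℝ φ (z - h z • e) v) • U z) ∂μ =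
        ∫ z in (Ω : Set E), ((fderiv ℝ (fun y => (1 - fderiv ℝ h y e) * φ (y - h y • e)) z v) • U z +
          (fderiv ℝ (fun y => fderiv ℝ h y v * φ (y - h y • e)) z e) • U z) ∂μ := by
      refine setIntegral_congr_fun hΩm fun z _ => ?_
      rw [smul_smul, jacobian_mul_fderiv_comp_shear hh hφ.contDiff z v (hne z), add_smul]
    -- Step 3: split and integrate by parts twice
    have IPi : IntegrableOn (fun z => (fderiv ℝ (fun y => (1 - fderiv ℝ h y e) * φ (y - h y • e)) z v) • U z)
        (Ω : Set E) μ :=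
      integrableOn_smul_of_locallyIntegrableOn hU.locallyIntegrableOn
        ((hP.contDiff.continuous_fderiv (by simp)).clm_apply continuous_const)
        (hP.hasCompactSupport.fderiv_apply (𝕜 := ℝ) v)
        ((tsupport_fderiv_apply_subset ℝ v).trans hP.tsupport_subset)
    have IRi : IntegrableOn (fun z => (fderiv ℝ (fun y => fderiv ℝ h y v * φ (y - h y • e)) z e) • U z)
        (Ω : Set E) μ :=
      integrableOn_smul_of_locallyIntegrableOn hU.locallyIntegrableOn
        ((hR.contDiff.continuous_fderiv (by simp)).clm_apply continuous_const)
        (hR.hasCompactSupport.fderiv_apply (𝕜 := ℝ) e)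
        ((tsupport_fderiv_apply_subset ℝ e).trans hR.tsupport_subset)
    have S3 : ∫ z in (Ω : Set E), ((fderiv ℝ (fun y => (1 - fderiv ℝ h y e) * φ (y - h y • e)) z v) • U z +
          (fderiv ℝ (fun y => fderiv ℝ h y v * φ (y - h y • e)) z e) • U z) ∂μ =
        -∫ z in (Ω : Set E), ((1 - fderiv ℝ h z e) * φ (z - h z • e)) • G z v ∂μ
          - ∫ z in (Ω : Set E), (fderiv ℝ h z v * φ (z - h z • e)) • G z e ∂μ := by
      rw [integral_add IPi IRi, IP, IR]
      abel
    -- Step 4: recombine the right-hand side pointwise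
    have JPi : IntegrableOn (fun z => ((1 - fderiv ℝ h z e) * φ (z - h z • e)) • G z v) (Ω : Set E) μ := by
      have := integrableOn_smul_of_locallyIntegrableOn
        ((ContinuousLinearMap.apply ℝ F v).locallyIntegrableOn_comp hU.locallyIntegrableOn_deriv)
        hP.contDiff.continuous hP.hasCompactSupport hP.tsupport_subset
      simpa only [Function.comp_def, ContinuousLinearMap.apply_apply] using this
    have JRi : IntegrableOn (fun z => (fderiv ℝ h z v * φ (z - h z • e)) • G z e) (Ω : Set E) μ := by
      have := integrableOn_smul_of_locallyIntegrableOn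
        ((ContinuousLinearMap.apply ℝ F e).locallyIntegrableOn_comp hU.locallyIntegrableOn_deriv)
        hR.contDiff.continuous hR.hasCompactSupport hR.tsupport_subset
      simpa only [Function.comp_def, ContinuousLinearMap.apply_apply] using this
    have S4 : -∫ z in (Ω : Set E), ((1 - fderiv ℝ h z e) * φ (z - h z • e)) • G z v ∂μ
          - ∫ z in (Ω : Set E), (fderiv ℝ h z v * φ (z - h z • e)) • G z e ∂μ =
        -∫ z in (Ω : Set E), (1 - fderiv ℝ h z e) • (φ (z - h z • e) •
          G z ((ContinuousLinearMap.id ℝ E + (1 - fderiv ℝ h z e)⁻¹ • (fderiv ℝ h z).smulRight e) v)) ∂μ := by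
      rw [← neg_add', ← integral_add JPi JRi]
      congr 1
      refine setIntegral_congr_fun hΩm fun z _ => ?_
      have key : (1 - fderiv ℝ h z e) •
          G z ((ContinuousLinearMap.id ℝ E + (1 - fderiv ℝ h z e)⁻¹ • (fderiv ℝ h z).smulRight e) v) =
          (1 - fderiv ℝ h z e) • G z v + fderiv ℝ h z v • G z e := by
        rw [← map_smul, one_sub_smul_inv_apply _ _ _ (hne z), map_add, map_smul, map_smul]
      rw [smul_comm (1 - fderiv ℝ h z e) (φ (z - h z • e)), key, smul_add, smul_smul, smul_smul, mul_comm]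
      congr 1
      rw [mul_comm]
    -- Step 5: substitute `x = Ψ z` on the right
    have S5 : ∫ x in (Ω : Set E), φ x • ((G (Φ x)).comp
          (ContinuousLinearMap.id ℝ E + (1 - fderiv ℝ h (Φ x) e)⁻¹ • (fderiv ℝ h (Φ x)).smulRight e)) v ∂μ =
        ∫ z in (Ω : Set E), (1 - fderiv ℝ h z e) • (φ (z - h z • e) •
          G z ((ContinuousLinearMap.id ℝ E + (1 - fderiv ℝ h z e)⁻¹ • (fderiv ℝ h z).smulRight e) v)) ∂μ := by
      have := setIntegral_comp_inverse_eq μ hhd hL he hL1 hΦl hΩm hΩ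
        (fun y => φ (y - h y • e) •
          G y ((ContinuousLinearMap.id ℝ E + (1 - fderiv ℝ h y e)⁻¹ • (fderiv ℝ h y).smulRight e) v))
      refine Eq.trans (setIntegral_congr_fun hΩm fun x _ => ?_) this
      have hx : Φ x - h (Φ x) • e = x := hΦr x
      simp only [ContinuousLinearMap.comp_apply, hx]
    rw [S1, S2, S3, S4, S5]

/-! ## §6 The competitor agrees with `U` off the support and takes the values of `U|_Ω` on `Ω` -/

omit [MeasurableSpace E] [BorelSpace E] [FiniteDimensional ℝ E] in
/-- **`W = U` off `tsupport h`.** [folklore] -/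
theorem comp_inverse_eq_of_notMem {Φ : E → E} (hΦl : LeftInverse Φ (fun z : E => z - h z • e))
    {F' : Type*} (U : E → F') {x : E} (hx : x ∉ tsupport h) : U (Φ x) = U x := by
  rw [inverse_eq_self hΦl hx]

omit [MeasurableSpace E] [BorelSpace E] [FiniteDimensional ℝ E] in
/-- **On `Ω ⊇ tsupport h` the competitor takes values of `U|_Ω`**: any pointwise property of `U` on `Ω` transfers to
`W := U ∘ Φ` on `Ω`. [folklore] -/
theorem forall_comp_inverse_of_forall {Φ : E → E} (hΦl : LeftInverse Φ (fun z : E => z - h z • e))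
    (hΦr : RightInverse Φ (fun z : E => z - h z • e)) {S : Set E} (hS : tsupport h ⊆ S)
    {F' : Type*} (U : E → F') {p : F' → Prop} (hU : ∀ z ∈ S, p (U z)) : ∀ x ∈ S, p (U (Φ x)) :=
  fun x hx => hU (Φ x) (inverse_mem_of_tsupport_subset hΦl hΦr hS hx)

end Summit.QuantumFields.YangMills.Theorems.PoincareLipschitzWeakChainRuleShear

end
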